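import Literature.NumberTheory.Transcendental.NesterenkoUResultant
import Literature.NumberTheory.Transcendental.NesterenkoEvalBounds
import Mathlib.LinearAlgebra.FiniteDimensional.Lemmas
import HarnessLib

/-!
# Specialising the first groups of skew variables of `ϰ` (towards LNM 1752 Ch. 3 Prop. 4.11 3), route B)

`Literature/NumberTheory/Transcendental/NesterenkoSkewSpecialize.lean`. Bookkeeping for the value
estimate 3) of Proposition 4.11 along the specialisation route. Nesterenko's `|I(ω̄)|`
(Definition 4.6) is the maximum modulus of the coefficients of `ϰ_ω̄(F) = F(S⁽¹⁾ω̄, …, S⁽ʳ⁾ω̄)`,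
the `S⁽ⁱ⁾` generic skew-symmetric matrices. For the `u`-resultant `G ∈ ℚ[u₁, …, u_s]` and the
associated form `F ∈ ℚ[u₁, …, u_{s+1}]` of `𝔭` we need to pass between `ϰ` and VALUES at a point
`t` of the skew variables of the first `s` groups:

* `zOf ω t` — the hyperplanes `zᵢ = S⁽ⁱ⁾(t) ω̄` (all through `ω̄`); `eval_kappa_eq_aeval` —
  `ϰ_ω̄(G)(t) = G(zOf ω t)`; `norm_zOf_le` — `|z_{ij}| ≤ (m+1)|ω̄|` for `|t| ≤ 1`;
* `blockSpec t` — specialising the first `s` groups of skew variables of `RS (s+1) m` at `t` and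
  keeping the last; `blockSpec_kappa` — `blockSpec t (ϰ_ω̄ F) = F(zOf ω t; S ω̄)`, the form
  `F(z; ·)` with the last group replaced by the generic skew row `S ω̄` (`aeval_map_splitLast`);
  `maxNorm_blockSpec_le` — `|blockSpec t P| ≤ #supp P · |P|` (`|t| ≤ 1`);
  `card_support_kappa_le` — `#supp ϰ_ω̄(F) ≤ #supp F · (m+1)^N` if all monomials of `F` have
  degree `N`;
* `injective_aeval_zOf` — **genericity**: if the coordinates `(t, ω̄)` are algebraically
  independent over `ℚ` then `u ↦ zOf ω t` is injective on `ℚ[u₁, …, u_s]` (`s < m + 1`): the map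
  `(S, ω̄) ↦ (S⁽ⁱ⁾ω̄)ᵢ` hits every rational point (`exists_rational_preimage_zOf`: choose
  `ω̄ ⊥ zᵢ`, `S⁽ⁱ⁾ = zᵢ aᵀ − a zᵢᵀ` with `a · ω̄ = 1`).

Definitions are plumbing with bodies (`zOf`, `blockSpec`, `skewEntryQ`, `lamQ`); no named facts.

## References

* [NesterenkoPhilippon2001] Yu. V. Nesterenko, P. Philippon (eds.), *Introduction to Algebraic
  Independence Theory*, LNM 1752, Springer 2001, Ch. 3 §4, Def. 4.6 (p. 39), Prop. 4.11
  (pp. 40–41).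
-/

noncomputable section

open MvPolynomial
open scoped Pointwise

namespace Literature.NumberTheory.Transcendental

namespace Nesterenko

variable {m : ℕ}

/-! ### Values of `ϰ` -/

/-- The hyperplanes `zᵢ = S⁽ⁱ⁾(t) ω̄` through `ω̄` determined by a point `t` of the skew variables.
[cite: NesterenkoPhilippon2001, Ch. 3 Def. 4.6 (p. 39)] -/
def zOf {s : ℕ} (ω : Fin (m + 1) → ℂ) (t : Fin s × SkewIdx m → ℂ) : Fin s × Fin (m + 1) → ℂ :=
  fun w => eval t (lam ω w.1 w.2)

/-- **`ϰ_ω̄(G)(t) = G(zOf ω t)`.** [folklore] -/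
theorem eval_kappa_eq_aeval {s : ℕ} (ω : Fin (m + 1) → ℂ) (t : Fin s × SkewIdx m → ℂ)
    (G : RU s m) : eval t (kappa ω G) = aeval (zOf ω t) G := by
  rw [kappa_eq_aeval_lam]
  have h := comp_aeval_apply (f := fun ij : Fin s × Fin (m + 1) => lam ω ij.1 ij.2)
    (φ := ((MvPolynomial.aeval t : RS s m →ₐ[ℂ] ℂ).restrictScalars ℚ)) (p := G)
  exact h

/-- `|P(t)| ≤ ‖P‖₁` for `|tᵥ| ≤ 1`. [folklore] -/
theorem norm_eval_le_l1Norm_fin {ι : Type*} [Fintype ι] (P : MvPolynomial ι ℂ) {t : ι → ℂ}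
    (ht : ∀ v, ‖t v‖ ≤ 1) :
    ‖eval t P‖ ≤ l1Norm P := by
  classical
  rw [eval_eq', l1Norm]
  refine (norm_sum_le _ _).trans (Finset.sum_le_sum fun e _ => ?_)
  rw [norm_mul, norm_prod]
  refine mul_le_of_le_one_right (norm_nonneg _) ?_
  exact Finset.prod_le_one (fun i _ => norm_nonneg _) fun i _ => by
    rw [norm_pow]; exact pow_le_one₀ (norm_nonneg _) (ht i)

/-- `|z_{ij}| ≤ (m+1)|ω̄|` for `|t| ≤ 1`. [folklore] -/
theorem norm_zOf_le {s : ℕ} (ω : Fin (m + 1) → ℂ) {t : Fin s × SkewIdx m → ℂ}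
    (ht : ∀ v, ‖t v‖ ≤ 1) (w : Fin s × Fin (m + 1)) : ‖zOf ω t w‖ ≤ (m + 1) * ‖ω‖ :=
  (norm_eval_le_l1Norm_fin _ ht).trans (l1Norm_lam_le ω w.1 w.2)

/-! ### Specialising the first `s` groups of skew variables -/

/-- `blockSpec t : ℂ[s⁽¹⁾, …, s⁽ˢ⁺¹⁾] → ℂ[s]`, `s⁽ⁱ⁾ ↦ t⁽ⁱ⁾` (`i ≤ s`), `s⁽ˢ⁺¹⁾ ↦ s`. [folklore] -/
def blockSpec {s : ℕ} (t : Fin s × SkewIdx m → ℂ) : RS (s + 1) m →ₐ[ℂ] RS 1 m :=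
  aeval fun v : Fin (s + 1) × SkewIdx m =>
    lastCombineSkew t v
  where
  /-- the substitution. [folklore] -/
  lastCombineSkew (t : Fin s × SkewIdx m → ℂ) (v : Fin (s + 1) × SkewIdx m) : RS 1 m :=
    Fin.lastCases (motive := fun _ => RS 1 m) (X ((0 : Fin 1), v.2)) (fun i => C (t (i, v.2))) v.1

/-- `blockSpec` on a variable of the last group. [folklore] -/
@[simp] theorem blockSpec_X_last {s : ℕ} (t : Fin s × SkewIdx m → ℂ) (p : SkewIdx m) :
    blockSpec t (X (Fin.last s, p)) = X ((0 : Fin 1), p) := by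
  simp [blockSpec, blockSpec.lastCombineSkew]

/-- `blockSpec` on a variable of the first `s` groups. [folklore] -/
@[simp] theorem blockSpec_X_castSucc {s : ℕ} (t : Fin s × SkewIdx m → ℂ) (i : Fin s) (p : SkewIdx m) :
    blockSpec t (X (Fin.castSucc i, p)) = C (t (i, p)) := by
  simp [blockSpec, blockSpec.lastCombineSkew]

/-- `blockSpec` on an entry of `S⁽ˢ⁺¹⁾`. [folklore] -/
theorem blockSpec_skewEntry_last {s : ℕ} (t : Fin s × SkewIdx m → ℂ) (j k : Fin (m + 1)) :
    blockSpec t (skewEntry (Fin.last s) j k) = skewEntry (0 : Fin 1) j k := by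
  unfold skewEntry
  split_ifs <;> simp

/-- `blockSpec` on an entry of `S⁽ⁱ⁾`, `i ≤ s`. [folklore] -/
theorem blockSpec_skewEntry_castSucc {s : ℕ} (t : Fin s × SkewIdx m → ℂ) (i : Fin s)
    (j k : Fin (m + 1)) :
    blockSpec t (skewEntry (Fin.castSucc i) j k) = C (eval t (skewEntry i j k)) := by
  unfold skewEntry
  split_ifs <;> simp

/-- `blockSpec (λ_{s+1, j}) = λ_{0 j}` (the generic last row). [folklore] -/
theorem blockSpec_lam_last {s : ℕ} (ω : Fin (m + 1) → ℂ) (t : Fin s × SkewIdx m → ℂ)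
    (j : Fin (m + 1)) : blockSpec t (lam ω (Fin.last s) j) = lam ω (0 : Fin 1) j := by
  simp only [lam, map_sum, map_mul, blockSpec_skewEntry_last, algHom_C, MvPolynomial.algebraMap_eq]

/-- `blockSpec (λ_{ij}) = z_{ij}` for `i ≤ s`. [folklore] -/
theorem blockSpec_lam_castSucc {s : ℕ} (ω : Fin (m + 1) → ℂ) (t : Fin s × SkewIdx m → ℂ)
    (i : Fin s) (j : Fin (m + 1)) :
    blockSpec t (lam ω (Fin.castSucc i) j) = C (zOf ω t (i, j)) := by
  rw [zOf, lam, lam, map_sum, map_sum, map_sum]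
  refine Finset.sum_congr rfl fun k _ => ?_
  rw [map_mul, blockSpec_skewEntry_castSucc, algHom_C, MvPolynomial.algebraMap_eq, map_mul, eval_C,
    C_mul]

/-- Evaluating the split form in an algebra: `aeval g (map φ (splitLast F))` is `F` evaluated at the
joint point. [folklore] -/
theorem aeval_map_splitLast {L A : Type*} [CommRing L] [Algebra ℚ L] [CommRing A] [Algebra L A]
    [Algebra ℚ A] [IsScalarTower ℚ L A]
    {s : ℕ} (φ : RU s m →ₐ[ℚ] L) (g : Fin (m + 1) → A) (F : RU (s + 1) m) :
    aeval g (MvPolynomial.map (φ : RU s m →+* L) (splitLast s m F)) =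
      aeval (R := ℚ) (lastCombine (fun w => algebraMap L A (φ (X w))) g) F := by
  have key : (((MvPolynomial.aeval g : MvPolynomial (Fin (m + 1)) L →ₐ[L] A) :
      MvPolynomial (Fin (m + 1)) L →+* A).comp
      (MvPolynomial.map (φ : RU s m →+* L))).comp
      (splitLast s m : RU (s + 1) m →+* MvPolynomial (Fin (m + 1)) (RU s m)) =
      ((aeval (R := ℚ) (lastCombine (fun w => algebraMap L A (φ (X w))) g) :
        RU (s + 1) m →ₐ[ℚ] A) : RU (s + 1) m →+* A) := by
    refine ringHom_ext (fun q => ?_) (fun w => ?_)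
    · change aeval g (MvPolynomial.map (φ : RU s m →+* L) (splitLast s m (C q))) = aeval _ (C q)
      rw [splitLast, aeval_C, MvPolynomial.algebraMap_apply, MvPolynomial.algebraMap_eq, map_C,
        aeval_C, aeval_C]
      change algebraMap L A (φ (algebraMap ℚ (RU s m) q)) = _
      rw [φ.commutes, ← IsScalarTower.algebraMap_apply]
    · obtain ⟨i, j⟩ := w
      induction i using Fin.lastCases with
      | last => simp
      | cast i => simp
  exact RingHom.congr_fun key F

/-- **`blockSpec t (ϰ_ω̄ F) = F(zOf ω t; S ω̄)`**: specialising the first `s` groups of skew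
variables in `ϰ_ω̄(F)` gives the form `F(z; ·)`, `z = zOf ω t`, with the last group of variables
replaced by the generic skew row `(S ω̄)ⱼ = λ_{0j}`. [folklore] -/
theorem blockSpec_kappa {s : ℕ} (ω : Fin (m + 1) → ℂ) (t : Fin s × SkewIdx m → ℂ)
    (F : RU (s + 1) m) :
    blockSpec t (kappa ω F) =
      aeval (fun j => lam ω (0 : Fin 1) j)
        (MvPolynomial.map ((aeval (zOf ω t) : RU s m →ₐ[ℚ] ℂ) : RU s m →+* ℂ)
          (splitLast s m F)) := by
  have hfun : (fun ij : Fin (s + 1) × Fin (m + 1) =>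
      ((blockSpec t).restrictScalars ℚ) (lam ω ij.1 ij.2)) =
      lastCombine (fun w => algebraMap ℂ (RS 1 m) ((aeval (zOf ω t) : RU s m →ₐ[ℚ] ℂ) (X w)))
        (fun j => lam ω (0 : Fin 1) j) := by
    funext ⟨i, j⟩
    change blockSpec t (lam ω i j) = _
    induction i using Fin.lastCases with
    | last => rw [blockSpec_lam_last, lastCombine_last]
    | cast i =>
      rw [blockSpec_lam_castSucc, lastCombine_castSucc, aeval_X, MvPolynomial.algebraMap_eq]
  rw [aeval_map_splitLast, kappa_eq_aeval_lam]
  change ((blockSpec t).restrictScalars ℚ)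
      (aeval (fun ij : Fin (s + 1) × Fin (m + 1) => lam ω ij.1 ij.2) F) = _
  rw [comp_aeval_apply, hfun]

/-- **`|blockSpec t P| ≤ #supp P · |P|` for `|t| ≤ 1`.** [folklore] -/
theorem maxNorm_blockSpec_le {s : ℕ} {t : Fin s × SkewIdx m → ℂ} (ht : ∀ v, ‖t v‖ ≤ 1)
    (P : RS (s + 1) m) : maxNorm (blockSpec t P) ≤ P.support.card * maxNorm P := by
  refine maxNorm_aeval_le_card_mul _ (fun v => ?_) P
  obtain ⟨i, p⟩ := v
  induction i using Fin.lastCases with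
  | last =>
    simp only [blockSpec.lastCombineSkew, Fin.lastCases_last]
    rw [l1Norm_X]
  | cast i =>
    simp only [blockSpec.lastCombineSkew, Fin.lastCases_castSucc]
    rw [l1Norm_C]
    exact ht (i, p)

/-! ### Counting the monomials of `ϰ_ω̄(F)` -/

section Card

variable {σ K : Type*} [CommSemiring K]

/-- `#supp(PQ) ≤ #supp P · #supp Q`. [folklore] -/
theorem card_support_mul_le' (P Q : MvPolynomial σ K) :
    (P * Q).support.card ≤ P.support.card * Q.support.card := by
  classical
  exact (Finset.card_le_card (support_mul P Q)).trans (Finset.card_add_le)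

/-- `#supp 1 ≤ 1`. [folklore] -/
theorem card_support_one_le : (1 : MvPolynomial σ K).support.card ≤ 1 := by
  classical
  rw [← C_1, C_apply]
  exact (Finset.card_le_card support_monomial_subset).trans (by simp)

/-- `#supp(P^k) ≤ (#supp P)^k`. [folklore] -/
theorem card_support_pow_le (P : MvPolynomial σ K) (k : ℕ) :
    (P ^ k).support.card ≤ P.support.card ^ k := by
  classical
  induction k with
  | zero =>
    rw [pow_zero, pow_zero]
    exact card_support_one_le
  | succ k ih =>
    rw [pow_succ, pow_succ]
    exact (card_support_mul_le' _ _).trans (Nat.mul_le_mul_right _ ih)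

/-- `#supp(∏ fᵢ) ≤ ∏ #supp fᵢ`. [folklore] -/
theorem card_support_prod_le {ι : Type*} (s : Finset ι) (f : ι → MvPolynomial σ K) :
    (∏ i ∈ s, f i).support.card ≤ ∏ i ∈ s, (f i).support.card := by
  classical
  induction s using Finset.induction_on with
  | empty => simpa using (card_support_one_le (σ := σ) (K := K))
  | insert a s ha ih =>
    rw [Finset.prod_insert ha, Finset.prod_insert ha]
    exact (card_support_mul_le' _ _).trans (Nat.mul_le_mul_left _ ih)

end Card

/-- **`#supp ϰ_ω̄(F) ≤ #supp F · (m+1)^N`** when every monomial of `F` has total degree `N` (each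
`u_{ij} ↦ λ_{ij}(ω̄)` has at most `m + 1` monomials). [folklore] -/
theorem card_support_kappa_le {r : ℕ} (ω : Fin (m + 1) → ℂ) (F : RU r m) {N : ℕ}
    (hF : ∀ γ ∈ F.support, γ.degree = N) :
    (kappa ω F).support.card ≤ F.support.card * (m + 1) ^ N := by
  classical
  rw [kappa_eq_sum]
  refine (Finset.card_le_card support_sum).trans (Finset.card_biUnion_le.trans ?_)
  rw [← smul_eq_mul]
  refine Finset.sum_le_card_nsmul _ _ _ fun γ hγ => ?_
  rw [C_mul']
  refine (Finset.card_le_card (support_smul (R := ℂ))).trans ?_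
  rw [Finsupp.prod]
  refine (card_support_prod_le _ _).trans ?_
  calc ∏ v ∈ γ.support, (lam ω v.1 v.2 ^ γ v).support.card
      ≤ ∏ v ∈ γ.support, (m + 1) ^ γ v := Finset.prod_le_prod' fun v _ =>
        (card_support_pow_le _ _).trans (Nat.pow_le_pow_left (card_support_linFactor_le ω v) _)
    _ = (m + 1) ^ N := by
        rw [Finset.prod_pow_eq_pow_sum, ← hF γ hγ]
        rfl

/-! ### Genericity of `(t, ω̄) ↦ zOf ω t` -/

/-- The entries of the generic skew-symmetric matrices `S⁽ⁱ⁾`, `i ≤ s`, as polynomials over `ℚ` in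
the skew variables AND the coordinates of `ω̄`. [folklore] -/
def skewEntryQ {s : ℕ} (i : Fin s) (j k : Fin (m + 1)) :
    MvPolynomial ((Fin s × SkewIdx m) ⊕ Fin (m + 1)) ℚ :=
  if h : j < k then X (Sum.inl (i, ⟨(j, k), h⟩))
  else if h' : k < j then -X (Sum.inl (i, ⟨(k, j), h'⟩)) else 0

/-- `λ_{ij} = ∑_k s⁽ⁱ⁾_{jk} ω_k` as a polynomial over `ℚ` in `(s, ω̄)`. [folklore] -/
def lamQ {s : ℕ} (i : Fin s) (j : Fin (m + 1)) :
    MvPolynomial ((Fin s × SkewIdx m) ⊕ Fin (m + 1)) ℚ :=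
  ∑ k : Fin (m + 1), skewEntryQ i j k * X (Sum.inr k)

/-- `s⁽ⁱ⁾_{jk}(t)` over any `ℚ`-algebra. [folklore] -/
theorem aeval_skewEntryQ {A : Type*} [CommRing A] [Algebra ℚ A] {s : ℕ} (t : Fin s × SkewIdx m → A)
    (ω : Fin (m + 1) → A) (i : Fin s) (j k : Fin (m + 1)) :
    aeval (Sum.elim t ω) (skewEntryQ i j k) =
      if h : j < k then t (i, ⟨(j, k), h⟩) else if h' : k < j then -t (i, ⟨(k, j), h'⟩) else 0 := by
  unfold skewEntryQ
  split_ifs <;> simp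

/-- `s⁽ⁱ⁾_{jk}(t)` over `ℂ` is the value of the tree's `skewEntry`. [folklore] -/
theorem eval_skewEntry_eq {s : ℕ} (t : Fin s × SkewIdx m → ℂ) (i : Fin s) (j k : Fin (m + 1)) :
    eval t (skewEntry i j k) =
      if h : j < k then t (i, ⟨(j, k), h⟩) else if h' : k < j then -t (i, ⟨(k, j), h'⟩) else 0 := by
  unfold skewEntry
  split_ifs <;> simp

/-- **`λ_{ij}(t, ω̄) = z_{ij}`.** [folklore] -/
theorem aeval_lamQ {s : ℕ} (ω : Fin (m + 1) → ℂ) (t : Fin s × SkewIdx m → ℂ) (i : Fin s)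
    (j : Fin (m + 1)) : aeval (Sum.elim t ω) (lamQ i j) = zOf ω t (i, j) := by
  rw [lamQ, map_sum, zOf]
  change _ = eval t (lam ω i j)
  rw [lam, map_sum]
  refine Finset.sum_congr rfl fun k _ => ?_
  rw [map_mul, aeval_X, Sum.elim_inr, map_mul, eval_C, aeval_skewEntryQ, eval_skewEntry_eq]

/-- **`G(zOf ω t) = (G ∘ λ)(t, ω̄)`**: evaluation at `zOf ω t` factors through the substitution
`u_{ij} ↦ λ_{ij}`. [folklore] -/
theorem aeval_zOf_eq {s : ℕ} (ω : Fin (m + 1) → ℂ) (t : Fin s × SkewIdx m → ℂ) (P : RU s m) :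
    aeval (zOf ω t) P =
      aeval (Sum.elim t ω) (aeval (fun w : Fin s × Fin (m + 1) => lamQ w.1 w.2) P) := by
  have h : (fun w : Fin s × Fin (m + 1) => aeval (Sum.elim t ω) (lamQ w.1 w.2)) = zOf ω t :=
    funext fun w => aeval_lamQ ω t w.1 w.2
  rw [comp_aeval_apply, h]

/-- **Every rational point is of the form `zOf`** (`s < m + 1`): given `z₀ ∈ ℚ^{s × (m+1)}` choose
`ω̄₀ ≠ 0` with `zᵢ · ω̄₀ = 0` for all `i` (`s` linear conditions in `m + 1` unknowns), `a` with
`a · ω̄₀ = 1`, and the skew matrices `S⁽ⁱ⁾ = zᵢ aᵀ − a zᵢᵀ`; then `S⁽ⁱ⁾ ω̄₀ = zᵢ`. [folklore] -/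
theorem exists_rational_preimage_zOf {s : ℕ} (hs : s < m + 1) (z₀ : Fin s × Fin (m + 1) → ℚ) :
    ∃ (t₀ : Fin s × SkewIdx m → ℚ) (ω₀ : Fin (m + 1) → ℚ),
      ∀ w : Fin s × Fin (m + 1), aeval (Sum.elim t₀ ω₀) (lamQ w.1 w.2) = z₀ w := by
  classical
  -- a non-zero `ω₀` orthogonal to the rows `zᵢ`
  let f : (Fin (m + 1) → ℚ) →ₗ[ℚ] (Fin s → ℚ) :=
    { toFun := fun ω i => ∑ k, z₀ (i, k) * ω k
      map_add' := fun x y => by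
        funext i
        simp only [Pi.add_apply, mul_add, Finset.sum_add_distrib]
      map_smul' := fun c x => by
        funext i
        simp only [Pi.smul_apply, smul_eq_mul, RingHom.id_apply, Finset.mul_sum]
        refine Finset.sum_congr rfl fun k _ => ?_
        ring }
  have hker : LinearMap.ker f ≠ ⊥ :=
    LinearMap.ker_ne_bot_of_finrank_lt (by simpa using hs)
  obtain ⟨ω₀, hω₀f, hω₀⟩ := (Submodule.ne_bot_iff _).mp hker
  have horth : ∀ i : Fin s, ∑ k, z₀ (i, k) * ω₀ k = 0 := fun i => by
    have := LinearMap.mem_ker.mp hω₀f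
    exact congr_fun this i
  -- `a` with `a · ω₀ = 1`
  set σ : ℚ := ∑ k, ω₀ k * ω₀ k with hσ
  have hσpos : 0 < σ := by
    obtain ⟨k, hk⟩ := Function.ne_iff.mp hω₀
    exact lt_of_lt_of_le (mul_self_pos.mpr hk)
      (Finset.single_le_sum (f := fun k => ω₀ k * ω₀ k) (fun k _ => mul_self_nonneg (ω₀ k))
        (Finset.mem_univ k))
  let a : Fin (m + 1) → ℚ := fun k => ω₀ k / σ
  have ha : ∑ k, a k * ω₀ k = 1 := by
    simp only [a, div_mul_eq_mul_div, ← Finset.sum_div]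
    exact div_self hσpos.ne'
  -- the skew matrices `S⁽ⁱ⁾ = zᵢ aᵀ − a zᵢᵀ`
  let t₀ : Fin s × SkewIdx m → ℚ := fun v => z₀ (v.1, v.2.1.1) * a v.2.1.2 - a v.2.1.1 * z₀ (v.1, v.2.1.2)
  refine ⟨t₀, ω₀, fun w => ?_⟩
  obtain ⟨i, j⟩ := w
  have hentry : ∀ k, aeval (Sum.elim t₀ ω₀) (skewEntryQ i j k) = z₀ (i, j) * a k - a j * z₀ (i, k) := by
    intro k
    rw [aeval_skewEntryQ]
    split_ifs with h h'
    · rfl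
    · simp only [t₀]; ring
    · have hjk : j = k := le_antisymm (not_lt.mp h') (not_lt.mp h)
      subst hjk; ring
  rw [lamQ, map_sum]
  simp only [map_mul, aeval_X, Sum.elim_inr, hentry]
  calc ∑ k, (z₀ (i, j) * a k - a j * z₀ (i, k)) * ω₀ k
      = z₀ (i, j) * ∑ k, a k * ω₀ k - a j * ∑ k, z₀ (i, k) * ω₀ k := by
        rw [Finset.mul_sum, Finset.mul_sum, ← Finset.sum_sub_distrib]
        refine Finset.sum_congr rfl fun k _ => ?_
        ring
    _ = z₀ (i, j) := by rw [ha, horth i, mul_one, mul_zero, sub_zero]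

/-- **The substitution `u_{ij} ↦ λ_{ij}` is injective on `ℚ[u₁, …, u_s]`** (`s < m + 1`): a polynomial
killed by it vanishes at every rational point. [folklore] -/
theorem aeval_lamQ_injective {s : ℕ} (hs : s < m + 1) :
    Function.Injective
      (aeval (fun w : Fin s × Fin (m + 1) => lamQ w.1 w.2) :
        RU s m →ₐ[ℚ] MvPolynomial ((Fin s × SkewIdx m) ⊕ Fin (m + 1)) ℚ) := by
  refine (injective_iff_map_eq_zero _).mpr fun P hP => ?_
  refine MvPolynomial.funext fun z₀ => ?_
  obtain ⟨t₀, ω₀, h⟩ := exists_rational_preimage_zOf hs z₀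
  have hz : z₀ = fun w => aeval (Sum.elim t₀ ω₀) (lamQ w.1 w.2) := funext fun w => (h w).symm
  rw [map_zero, hz, ← coe_aeval_eq_eval]
  change aeval (fun w => aeval (Sum.elim t₀ ω₀) ((fun w : Fin s × Fin (m + 1) => lamQ w.1 w.2) w)) P = 0
  rw [← comp_aeval_apply, hP, map_zero]

/-- **Genericity of `zOf`**: if the coordinates of `(t, ω̄)` are algebraically independent over `ℚ`
(`aeval (t, ω̄)` injective on `ℚ[s, ω̄]`) then `u ↦ zOf ω t` is injective on `ℚ[u₁, …, u_s]`
(`s < m + 1`). [folklore] -/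
theorem injective_aeval_zOf {s : ℕ} (hs : s < m + 1) {ω : Fin (m + 1) → ℂ} {t : Fin s × SkewIdx m → ℂ}
    (hgen : Function.Injective
      (aeval (Sum.elim t ω) : MvPolynomial ((Fin s × SkewIdx m) ⊕ Fin (m + 1)) ℚ →ₐ[ℚ] ℂ)) :
    Function.Injective (aeval (zOf ω t) : RU s m →ₐ[ℚ] ℂ) := fun P P' h => by
  rw [aeval_zOf_eq, aeval_zOf_eq] at h
  exact aeval_lamQ_injective hs (hgen h)

end Nesterenko

end Literature.NumberTheory.Transcendental

end
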